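/-
HONEST FRAMING: systematic search; no irrationality claim unless certified.
(Filed for `fam-elim` by P2; one docstring added for the gate's lint, statements and proofs byte-identical.)
Staged by fam-elim gen-2 (planner-pub-zeta5-fam-elim-g2-0) for
`Summits/KontsevichZagierPeriods/Zeta5Search/Elimination/CasoratianVandermonde.lean` (E-L3).
-/
import Mathlib
import HarnessLib
import Literature.Analysis.Asymptotics.PoincareRatioTheorem

/-!
# Zeta5Search / Elimination / CasoratianVandermonde — `k × k` eliminants of sequences with distinct ratio limits have NO cancellation

Companion to `Elimination/StepEliminant.lean` (the `k = 2` case, FAMILY.md `families/elim` §5 P2′) and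
to fam-vwp's / fam-indep's higher-rank elimination entries (FAMILY.md `families/elim` §11, v2 rows).

**Setting.** Eliminating `k − 1` unwanted constants (say `ζ(3)`, or `ζ(3)` and `ζ(7)`) from `k` members of a
family of linear forms is a `k × k` determinant step.  When the `k` members are consecutive shifts
`n, n+1, …, n+k-1` of `k` sequences `x₀, …, x_{k-1}` (the form and the unwanted coefficient sequences) the
eliminant is the CASORATIAN-type minor `seqCasoratian x n = det [x_i (n + j)]_{i,j<k}`.

**Theorems (all [folklore]; real sequences, hypotheses = eventual non-vanishing + ratio limits).**
* `seqCasoratian_eq_prod_mul_det` — `seqCasoratian x n = (∏ᵢ xᵢ n) · det [xᵢ(n+j)/xᵢ(n)]`;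
* `tendsto_shift_div` — `xᵢ(n+j)/xᵢ(n) → Λᵢ^j` when `xᵢ(n+1)/xᵢ(n) → Λᵢ`;
* `tendsto_seqCasoratian_div` — `seqCasoratian x n / ∏ᵢ xᵢ n → det (vandermonde Λ) = ∏_{i<j} (Λⱼ − Λᵢ)`;
* `seqCasoratian_eventually_two_sided`, `seqCasoratian_eventually_ne_zero` — if the `Λᵢ` are pairwise DISTINCT the
  minor is eventually two-sidedly comparable to the product of its diagonal-scale entries `∏ᵢ xᵢ n`: NO cancellation;
* `tendsto_log_abs_seqCasoratian_div` — then `log |seqCasoratian x n| / n → ∑ᵢ log |Λᵢ|`: the exponential RATE of the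
  eliminant is the SUM of the rates of the `k` sequences (Poincaré's Lemma 7.14 per sequence,
  `Literature.Analysis.Asymptotics.PoincareRecurrence.tendsto_log_abs_div_of_tendsto_ratio`);
* `tendsto_seqCasoratian_div_of_not_injective` — conversely, if two ratio limits COINCIDE the normalised minor tends
  to `0`: the leading term cancels.  (This is why, in a `3 × 3` minor whose two coefficient rows share the dominant
  root, the naive product rule is NOT attained — FAMILY.md §11 — while for the `2 × 2` step eliminant of a form
  (`Λ = λ_min`) against a coefficient (`Λ = λ_max`) nothing cancels.)

Naming: `seqCasoratian` (real sequences, this file) is unrelated to the p-adic `CasoratianValuation.casoratian` of the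
cluster-valuation files and to the specific order-3 Casoratian of `Zudilin2002CasoratianRates.lean` (which is the
DEGENERATE case below: `pₙ, qₙ` share the dominant root, so `qₙpₙ₊₁ − qₙ₊₁pₙ = o(qₙpₙ)` and its true rate is a second compound).
MODEL-free: these are statements about arbitrary real sequences; which `Λᵢ` occur for a given family is the
family designer's (Poincaré–Perron) input.  No statement about denominators is made here — by FAMILY.md §5 P2′/§12
the denominator of the minor is the ONLY lever of a same-module elimination.
-/

noncomputable section

open Filter Finset
open scoped Topology BigOperators

namespace Summit.KontsevichZagierPeriods.Zeta5Search.Elimination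

/-! ## Two analytic helpers -/

/-- If `q n → c ≠ 0` then `log |q n| / n → 0`. [folklore] -/
theorem tendsto_log_abs_div_nat_of_tendsto {q : ℕ → ℝ} {c : ℝ} (hq : Tendsto q atTop (𝓝 c))
    (hc : c ≠ 0) : Tendsto (fun n => Real.log |q n| / n) atTop (𝓝 0) := by
  have h1 : Tendsto (fun n => Real.log |q n|) atTop (𝓝 (Real.log |c|)) :=
    (hq.abs).log (abs_ne_zero.2 hc)
  have h := h1.mul tendsto_inv_atTop_nhds_zero_nat
  rw [mul_zero] at h
  simpa only [div_eq_mul_inv] using h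

/-- NO-CANCELLATION PRINCIPLE, abstract form. If `E n / p n → c ≠ 0` with `p n` eventually non-zero then
eventually `(|c|/2)|p n| ≤ |E n| ≤ 2|c| |p n|`. [folklore] -/
theorem eventually_two_sided_of_tendsto_div {E p : ℕ → ℝ} {c : ℝ}
    (hp : ∀ᶠ n in atTop, p n ≠ 0) (hq : Tendsto (fun n => E n / p n) atTop (𝓝 c)) (hc : c ≠ 0) :
    ∀ᶠ n in atTop, |c| / 2 * |p n| ≤ |E n| ∧ |E n| ≤ 2 * |c| * |p n| := by
  have hgap : 0 < |c| / 2 := by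
    have : 0 < |c| := abs_pos.2 hc
    linarith
  have hclose : ∀ᶠ n in atTop, |E n / p n - c| < |c| / 2 := by
    obtain ⟨M, hM⟩ := (Metric.tendsto_atTop.1 hq) _ hgap
    filter_upwards [eventually_ge_atTop M] with n hn
    have := hM n hn
    rwa [Real.dist_eq] at this
  filter_upwards [hclose, hp] with n hn hpn
  have hp0 : 0 < |p n| := abs_pos.2 hpn
  have hq' : |E n| = |E n / p n| * |p n| := by
    rw [abs_div, div_mul_cancel₀ _ (ne_of_gt hp0)]
  have h1 : |c| / 2 ≤ |E n / p n| := by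
    have := abs_sub_abs_le_abs_sub c (E n / p n)
    rw [abs_sub_comm] at hn
    linarith
  have h2 : |E n / p n| ≤ 2 * |c| := by
    have := abs_sub_abs_le_abs_sub (E n / p n) c
    have h0 : 0 ≤ |c| := abs_nonneg _
    linarith
  constructor
  · rw [hq']; exact mul_le_mul_of_nonneg_right h1 (le_of_lt hp0)
  · rw [hq']; exact mul_le_mul_of_nonneg_right h2 (le_of_lt hp0)

/-- … and then `E n` is eventually non-zero. [folklore] -/
theorem eventually_ne_zero_of_tendsto_div {E p : ℕ → ℝ} {c : ℝ}
    (hp : ∀ᶠ n in atTop, p n ≠ 0) (hq : Tendsto (fun n => E n / p n) atTop (𝓝 c)) (hc : c ≠ 0) :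
    ∀ᶠ n in atTop, E n ≠ 0 := by
  have hgap : 0 < |c| / 2 := by
    have : 0 < |c| := abs_pos.2 hc
    linarith
  filter_upwards [eventually_two_sided_of_tendsto_div hp hq hc, hp] with n hn hpn
  have : 0 < |E n| := lt_of_lt_of_le (mul_pos hgap (abs_pos.2 hpn)) hn.1
  exact abs_pos.1 this

/-- RATE TRANSFER. If `E n / p n → c ≠ 0`, `p n` eventually non-zero and `log |p n| / n → ρ` then
`log |E n| / n → ρ`. [folklore] -/
theorem tendsto_log_abs_div_nat_of_tendsto_div {E p : ℕ → ℝ} {c ρ : ℝ}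
    (hp : ∀ᶠ n in atTop, p n ≠ 0) (hq : Tendsto (fun n => E n / p n) atTop (𝓝 c)) (hc : c ≠ 0)
    (hρ : Tendsto (fun n => Real.log |p n| / n) atTop (𝓝 ρ)) :
    Tendsto (fun n => Real.log |E n| / n) atTop (𝓝 ρ) := by
  have h0 := tendsto_log_abs_div_nat_of_tendsto hq hc
  have hev : ∀ᶠ n in atTop, Real.log |E n / p n| / n + Real.log |p n| / n = Real.log |E n| / n := by
    filter_upwards [eventually_ne_zero_of_tendsto_div hp hq hc, hp] with n hEn hpn
    rw [abs_div, Real.log_div (abs_ne_zero.2 hEn) (abs_ne_zero.2 hpn)]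
    ring
  have hsum := h0.add hρ
  rw [zero_add] at hsum
  exact hsum.congr' hev

/-- SHIFTED RATIOS. If `u n ≠ 0` for `n ≥ N` and `u (n+1) / u n → L` then `u (n+j) / u n → L^j`. [folklore] -/
theorem tendsto_shift_div (u : ℕ → ℝ) {L : ℝ} (N : ℕ) (hu : ∀ n, N ≤ n → u n ≠ 0)
    (hr : Tendsto (fun n => u (n + 1) / u n) atTop (𝓝 L)) (j : ℕ) :
    Tendsto (fun n => u (n + j) / u n) atTop (𝓝 (L ^ j)) := by
  induction j with
  | zero =>
    simp only [add_zero, pow_zero]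
    refine tendsto_const_nhds.congr' ?_
    filter_upwards [eventually_ge_atTop N] with n hn
    rw [div_self (hu n hn)]
  | succ j ih =>
    have hs : Tendsto (fun n => u (n + j + 1) / u (n + j)) atTop (𝓝 L) :=
      hr.comp (tendsto_add_atTop_nat j)
    have h := hs.mul ih
    rw [← pow_succ'] at h
    refine h.congr' ?_
    filter_upwards [eventually_ge_atTop N] with n hn
    have h0 : u (n + j) ≠ 0 := hu _ (by omega)
    have h1 : u n ≠ 0 := hu _ hn
    rw [show n + (j + 1) = n + j + 1 by ring, div_mul_div_comm, mul_comm (u (n + j)) (u n),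
      ← div_mul_div_comm, div_self h0, mul_one]

/-! ## Determinants of entrywise-convergent matrices -/

/-- If every entry of `M n` converges to the corresponding entry of `A` then `det (M n) → det A`
(the determinant is a polynomial in the entries). [folklore] -/
theorem tendsto_det_of_tendsto_entries {m : Type*} [Fintype m] [DecidableEq m]
    {M : ℕ → Matrix m m ℝ} {A : Matrix m m ℝ}
    (h : ∀ i j, Tendsto (fun n => M n i j) atTop (𝓝 (A i j))) :
    Tendsto (fun n => (M n).det) atTop (𝓝 A.det) := by
  simp_rw [Matrix.det_apply']
  refine tendsto_finsetSum _ fun σ _ => ?_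
  exact (tendsto_finsetProd _ fun i _ => h (σ i) i).const_mul _

/-! ## The Casoratian-type eliminant -/

variable {k : ℕ}

/-- The `k × k` Casoratian-type minor of `k` sequences at index `n`: `det [x i (n + j)]_{i,j < k}`. [folklore] -/
def seqCasoratian (x : Fin k → ℕ → ℝ) (n : ℕ) : ℝ :=
  (Matrix.of fun i j : Fin k => x i (n + (j : ℕ))).det

/-- The matrix of normalised entries `x i (n + j) / x i n`. [folklore] -/
def ratioMatrix (x : Fin k → ℕ → ℝ) (n : ℕ) : Matrix (Fin k) (Fin k) ℝ :=
  Matrix.of fun i j : Fin k => x i (n + (j : ℕ)) / x i n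

/-- Unfolding lemma for `seqCasoratian`. -/
theorem seqCasoratian_def (x : Fin k → ℕ → ℝ) (n : ℕ) :
    seqCasoratian x n = (Matrix.of fun i j : Fin k => x i (n + (j : ℕ))).det := rfl

/-- `k = 2`: the Casoratian minor is the step eliminant `x₀(n) x₁(n+1) − x₀(n+1) x₁(n)` (cf.
`Elimination/StepEliminant.lean`, `stepElim x₁ x₀ n`). [folklore] -/
theorem seqCasoratian_fin_two (x : Fin 2 → ℕ → ℝ) (n : ℕ) :
    seqCasoratian x n = x 0 n * x 1 (n + 1) - x 0 (n + 1) * x 1 n := by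
  rw [seqCasoratian_def, Matrix.det_fin_two]
  simp [Matrix.of_apply]

/-- Row scaling: `seqCasoratian x n = (∏ i, x i n) · det (ratioMatrix x n)` when every `x i n ≠ 0`. [folklore] -/
theorem seqCasoratian_eq_prod_mul_det (x : Fin k → ℕ → ℝ) {n : ℕ} (hx : ∀ i, x i n ≠ 0) :
    seqCasoratian x n = (∏ i, x i n) * (ratioMatrix x n).det := by
  unfold seqCasoratian ratioMatrix
  rw [← Matrix.det_mul_column]
  congr 1
  ext i j
  simp only [Matrix.of_apply]
  rw [mul_div_cancel₀ _ (hx i)]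

/-- ENTRYWISE LIMIT: the normalised matrix tends to the Vandermonde matrix of the ratio limits. [folklore] -/
theorem tendsto_ratioMatrix_entry (x : Fin k → ℕ → ℝ) {Λ : Fin k → ℝ} (N : ℕ)
    (hx : ∀ i n, N ≤ n → x i n ≠ 0)
    (hr : ∀ i, Tendsto (fun n => x i (n + 1) / x i n) atTop (𝓝 (Λ i))) (i j : Fin k) :
    Tendsto (fun n => ratioMatrix x n i j) atTop (𝓝 (Matrix.vandermonde Λ i j)) := by
  simp only [ratioMatrix, Matrix.of_apply, Matrix.vandermonde_apply]
  exact tendsto_shift_div (x i) N (hx i) (hr i) j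

/-- MAIN LIMIT. `seqCasoratian x n / ∏ i, x i n → det (vandermonde Λ) = ∏_{i<j} (Λ j − Λ i)`. [folklore] -/
theorem tendsto_seqCasoratian_div (x : Fin k → ℕ → ℝ) {Λ : Fin k → ℝ} (N : ℕ)
    (hx : ∀ i n, N ≤ n → x i n ≠ 0)
    (hr : ∀ i, Tendsto (fun n => x i (n + 1) / x i n) atTop (𝓝 (Λ i))) :
    Tendsto (fun n => seqCasoratian x n / ∏ i, x i n) atTop (𝓝 (Matrix.vandermonde Λ).det) := by
  have hdet : Tendsto (fun n => (ratioMatrix x n).det) atTop (𝓝 (Matrix.vandermonde Λ).det) :=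
    tendsto_det_of_tendsto_entries (tendsto_ratioMatrix_entry x N hx hr)
  refine hdet.congr' ?_
  filter_upwards [eventually_ge_atTop N] with n hn
  have hx' : ∀ i, x i n ≠ 0 := fun i => hx i n hn
  have hP : (∏ i, x i n) ≠ 0 := Finset.prod_ne_zero_iff.mpr fun i _ => hx' i
  rw [seqCasoratian_eq_prod_mul_det x hx', mul_div_cancel_left₀ _ hP]

/-- The same limit written as the Vandermonde product. [folklore] -/
theorem tendsto_seqCasoratian_div' (x : Fin k → ℕ → ℝ) {Λ : Fin k → ℝ} (N : ℕ)
    (hx : ∀ i n, N ≤ n → x i n ≠ 0)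
    (hr : ∀ i, Tendsto (fun n => x i (n + 1) / x i n) atTop (𝓝 (Λ i))) :
    Tendsto (fun n => seqCasoratian x n / ∏ i, x i n) atTop
      (𝓝 (∏ i : Fin k, ∏ j ∈ Ioi i, (Λ j - Λ i))) := by
  rw [← Matrix.det_vandermonde]
  exact tendsto_seqCasoratian_div x N hx hr

/-- DEGENERATE CASE: if two ratio limits coincide the normalised minor tends to `0` — the leading term
cancels. [folklore] -/
theorem tendsto_seqCasoratian_div_of_not_injective (x : Fin k → ℕ → ℝ) {Λ : Fin k → ℝ} (N : ℕ)
    (hx : ∀ i n, N ≤ n → x i n ≠ 0)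
    (hr : ∀ i, Tendsto (fun n => x i (n + 1) / x i n) atTop (𝓝 (Λ i)))
    (hΛ : ¬ Function.Injective Λ) :
    Tendsto (fun n => seqCasoratian x n / ∏ i, x i n) atTop (𝓝 0) := by
  have h0 : (Matrix.vandermonde Λ).det = 0 := by
    by_contra h
    exact hΛ (Matrix.det_vandermonde_ne_zero_iff.1 h)
  have h := tendsto_seqCasoratian_div x N hx hr
  rwa [h0] at h

/-- The product `∏ i, x i n` is non-zero on the tail. -/
theorem prod_eventually_ne_zero (x : Fin k → ℕ → ℝ) (N : ℕ) (hx : ∀ i n, N ≤ n → x i n ≠ 0) :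
    ∀ᶠ n in atTop, (∏ i, x i n) ≠ 0 := by
  filter_upwards [eventually_ge_atTop N] with n hn
  exact Finset.prod_ne_zero_iff.mpr fun i _ => hx i n hn

/-- NO CANCELLATION. If the ratio limits are pairwise distinct then eventually
`(|V|/2)·|∏ xᵢ n| ≤ |seqCasoratian x n| ≤ 2|V|·|∏ xᵢ n|`, `V = det (vandermonde Λ) ≠ 0`. [folklore] -/
theorem seqCasoratian_eventually_two_sided (x : Fin k → ℕ → ℝ) {Λ : Fin k → ℝ} (N : ℕ)
    (hx : ∀ i n, N ≤ n → x i n ≠ 0)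
    (hr : ∀ i, Tendsto (fun n => x i (n + 1) / x i n) atTop (𝓝 (Λ i)))
    (hinj : Function.Injective Λ) :
    ∀ᶠ n in atTop, |(Matrix.vandermonde Λ).det| / 2 * |∏ i, x i n| ≤ |seqCasoratian x n| ∧
      |seqCasoratian x n| ≤ 2 * |(Matrix.vandermonde Λ).det| * |∏ i, x i n| :=
  eventually_two_sided_of_tendsto_div (prod_eventually_ne_zero x N hx)
    (tendsto_seqCasoratian_div x N hx hr) (Matrix.det_vandermonde_ne_zero_iff.2 hinj)

/-- … in particular the eliminant is eventually non-zero. [folklore] -/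
theorem seqCasoratian_eventually_ne_zero (x : Fin k → ℕ → ℝ) {Λ : Fin k → ℝ} (N : ℕ)
    (hx : ∀ i n, N ≤ n → x i n ≠ 0)
    (hr : ∀ i, Tendsto (fun n => x i (n + 1) / x i n) atTop (𝓝 (Λ i)))
    (hinj : Function.Injective Λ) :
    ∀ᶠ n in atTop, seqCasoratian x n ≠ 0 :=
  eventually_ne_zero_of_tendsto_div (prod_eventually_ne_zero x N hx)
    (tendsto_seqCasoratian_div x N hx hr) (Matrix.det_vandermonde_ne_zero_iff.2 hinj)

/-- RATE of the product of the sequences: `log |∏ xᵢ n| / n → ∑ log |Λᵢ|` (Poincaré per factor). [folklore] -/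
theorem tendsto_log_abs_prod_div (x : Fin k → ℕ → ℝ) {Λ : Fin k → ℝ} (N : ℕ)
    (hx : ∀ i n, N ≤ n → x i n ≠ 0)
    (hr : ∀ i, Tendsto (fun n => x i (n + 1) / x i n) atTop (𝓝 (Λ i)))
    (hΛ : ∀ i, Λ i ≠ 0) :
    Tendsto (fun n => Real.log |∏ i, x i n| / n) atTop (𝓝 (∑ i, Real.log |Λ i|)) := by
  have hi : ∀ i, Tendsto (fun n => Real.log |x i n| / n) atTop (𝓝 (Real.log |Λ i|)) := fun i =>
    Literature.Analysis.Asymptotics.PoincareRecurrence.tendsto_log_abs_div_of_tendsto_ratio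
      (x i) N (hx i) (hΛ i) (hr i)
  have hsum := tendsto_finsetSum (Finset.univ : Finset (Fin k)) fun i _ => hi i
  refine hsum.congr' ?_
  filter_upwards [eventually_ge_atTop N] with n hn
  rw [Finset.abs_prod, Real.log_prod fun i _ => abs_ne_zero.2 (hx i n hn), Finset.sum_div]

/-- RATE OF THE ELIMINANT = SUM OF THE RATES. If the ratio limits `Λᵢ` are non-zero and pairwise distinct
then `log |seqCasoratian x n| / n → ∑ᵢ log |Λᵢ|`: a `k × k` shift-eliminant saves NOTHING over the product
of the sizes of its `k` entries. [folklore] -/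
theorem tendsto_log_abs_seqCasoratian_div (x : Fin k → ℕ → ℝ) {Λ : Fin k → ℝ} (N : ℕ)
    (hx : ∀ i n, N ≤ n → x i n ≠ 0)
    (hr : ∀ i, Tendsto (fun n => x i (n + 1) / x i n) atTop (𝓝 (Λ i)))
    (hΛ : ∀ i, Λ i ≠ 0) (hinj : Function.Injective Λ) :
    Tendsto (fun n => Real.log |seqCasoratian x n| / n) atTop (𝓝 (∑ i, Real.log |Λ i|)) :=
  tendsto_log_abs_div_nat_of_tendsto_div (prod_eventually_ne_zero x N hx)
    (tendsto_seqCasoratian_div x N hx hr) (Matrix.det_vandermonde_ne_zero_iff.2 hinj)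
    (tendsto_log_abs_prod_div x N hx hr hΛ)

end Summit.KontsevichZagierPeriods.Zeta5Search.Elimination

end
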